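import Mathlib.Topology.UnitInterval
import Mathlib.Topology.Order.IntermediateValue
import Mathlib.Topology.Order.Compact
import Mathlib.Topology.UniformSpace.HeineCantor
import Mathlib.Topology.MetricSpace.Pseudo.Lemmas
import Mathlib.Order.CompleteLatticeIntervals
import Mathlib.Algebra.BigOperators.Intervals
import Mathlib.Algebra.Order.BigOperators.Group.Finset
import Mathlib.Data.Finset.Sort
import Literature.Probability.RandomPlanarGeometry.Curve
import Literature.Probability.RandomPlanarGeometry.CurveSpace
import HarnessLib

/-!
# Tortuosity of curves, multiple traversals of spherical shells, compactness in curve space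

Trunk `Stoch` (topic `Probability/RandomPlanarGeometry`). The deterministic half of
M. Aizenman, A. Burchard, *Hölder regularity and dimension bounds for random curves*, Duke
Math. J. 99 (1999) 419–453 (arXiv:math/9801027), §2 and Lemma 4.1, in the form consumed by the
tightness criterion of `CurveTightness.lean` (AB99 Thms 1.1–1.2) and, downstream, by the
percolation interface statements `Literature.Probability.Percolation.isTightLaws_map_bondInterface` /
`isTightLaws_map_triInterface`.

* `Curve.reverse` — time reversal of a parametrised curve.
* `Curve.IsTraversal γ x r R s t`, `Curve.HasTraversals γ k x r R` — the segment of `γ` on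
  `[s, t]` joins the closed ball `B̄(x, r)` to the exterior `{dist · x ≥ R}` of the shell
  `D(x; r, R)`, resp. `γ` has `k` such segments on pairwise disjoint parameter intervals
  ("`D(x; r, R)` is traversed by `k` separate segments of the curve", AB99 §1.b, (1.2)–(1.3);
  "`k`-fold crossing", AB99 §2.d). Monotone in `k`, in the shell, invariant under reversal;
  every curve traverses a genuine shell only finitely often (`Curve.exists_not_hasTraversals`).
* `Curve.IsDivision γ ℓ P`, `Curve.tortuosity γ ℓ` — a finite set of times `P ∋ 0, 1` cutting
  `γ` into segments of size `≤ ℓ`, and the tortuosity `M(γ, ℓ)`, the minimal number of segments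
  of such a division (AB99 §2.b). `Curve.exists_isDivision`: divisions exist for every `ℓ > 0`
  (uniform continuity).
* `Curve.exists_isDivision_of_cover` — **AB99 eq. (2.22)** (proof of Thm 2.5), the greedy
  first-exit algorithm: if the trace of `γ` is covered by the closed `ρ`-balls about the points
  of a finite set `S`, `2ρ < a`, and for no `y ∈ S` the shell `D(y; ρ, a - ρ)` is traversed by
  `k y` separate segments, then `γ` has a division of size `2a` with at most `∑_{y ∈ S} k y`
  segments. (AB99 state it with a constant `k` and coverings by balls of diameter `ℓ^{1+ε}`;
  the position-dependent threshold costs nothing and is what the boundary of a domain needs.)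
* `exists_orderIso_unitInterval_apply_eq` — an increasing self-homeomorphism of `[0, 1]`
  through finitely many prescribed points (piecewise linear, written as a sum of ramps).
* `CurveClass.isCompact_closure_image_mk_of_tortuosity_le` — **AB99 Lemma 4.1 (⇐)**: classes of
  curves in a compact `Λ` obeying a uniform tortuosity bound at arbitrarily small scales form a
  relatively compact subset of `CurveClass E` (`E` complete). AB99 prove it through Lemma 2.4
  (reparametrisation with a uniform modulus) and Arzelà–Ascoli; we prove total boundedness
  directly (two curves with the same "code" — same number of division points, nearby division
  values — are close after matching the divisions, `dist_mk_mk_le_of_isDivision`) and use the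
  completeness of `CurveClass E` (`CurveClass.instCompleteSpace`).

Mathlib: `IsCompact.exists_isLeast`, `intermediate_value_Icc` (on `unitInterval`, a complete
linear order with the order topology), `Set.Icc.addNSMul`, `Finset.orderEmbOfFin`,
`Metric.totallyBounded_of_finite_discretization`, `TotallyBounded.closure`,
`TotallyBounded.isCompact_of_isClosed`. Mathlib has no tortuosity / annulus-traversal notions
(searched `tortuosity`, `traverse`, `upcrossing` — the latter only for real processes).
-/

open Set Filter Topology Metric
open scoped unitInterval

noncomputable section

namespace Literature.Probability.RandomPlanarGeometry

variable {E : Type*}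

namespace Curve

/-! ### Time reversal -/

section Reverse

variable [TopologicalSpace E]

/-- Time reversal of a parametrised curve, `t ↦ γ (1 - t)` (Mathlib's `unitInterval.symm`).
(Aizenman–Burchard 1999, §2.a: curves as equivalence classes of parametrisations; reversal
changes the orientation only.) [cite: AizenmanBurchard1999, §2.a] -/
def reverse (γ : Curve E) : Curve E :=
  ⟨γ.toContinuousMap.comp ⟨σ, unitInterval.continuous_symm⟩⟩

/-- `γ.reverse t = γ (1 - t)`. [cite: AizenmanBurchard1999, §2.a] -/
@[simp] theorem reverse_apply (γ : Curve E) (t : I) : γ.reverse t = γ (σ t) := rfl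

/-- Time reversal is an involution. [cite: AizenmanBurchard1999, §2.a] -/
@[simp] theorem reverse_reverse (γ : Curve E) : γ.reverse.reverse = γ := by
  ext t
  simp

/-- Time reversal does not change the trace. [cite: AizenmanBurchard1999, §2.a] -/
@[simp] theorem range_reverse (γ : Curve E) : γ.reverse.range = γ.range := by
  change Set.range (fun t ↦ γ (σ t)) = Set.range γ
  exact unitInterval.symm_bijective.surjective.range_comp γ

end Reverse

/-! ### Traversals of spherical shells -/

section Traversal

variable [PseudoMetricSpace E]

/-- The segment of the curve `γ` between the times `s ≤ t` **traverses the spherical shell**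
`D(x; r, R)`: one of its endpoints lies in the closed ball of radius `r` about `x` and the other
one outside the open ball of radius `R` (in either order). Any segment joining the two
components of the complement of the shell contains a sub-segment inside the closed shell
joining its two boundary spheres, so for counting separate traversals this is the notion of
Aizenman–Burchard, Duke Math. J. 99 (1999), §1.b, eq. (1.2)–(1.3) and Fig. 2.
[cite: AizenmanBurchard1999, §1.b (1.2)-(1.3)] -/
def IsTraversal (γ : Curve E) (x : E) (r R : ℝ) (s t : I) : Prop :=
  s ≤ t ∧ ((dist (γ s) x ≤ r ∧ R ≤ dist (γ t) x) ∨ (R ≤ dist (γ s) x ∧ dist (γ t) x ≤ r))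

/-- **`k` separate traversals** ("`k`-fold crossing"): the shell `D(x; r, R)` is traversed by
`k` segments `γ|[s i, t i]` of the curve on pairwise disjoint parameter intervals, listed in
increasing order (`t i < s j` for `i < j`). (Aizenman–Burchard 1999, §1.b (1.3): "`D(x; r, R)`
is traversed by `k` separate segments of the curve"; §2.d: `k`-fold crossings.)
[cite: AizenmanBurchard1999, §1.b (1.3) and §2.d] -/
def HasTraversals (γ : Curve E) (k : ℕ) (x : E) (r R : ℝ) : Prop :=
  ∃ s t : Fin k → I, (∀ i, γ.IsTraversal x r R (s i) (t i)) ∧ ∀ ⦃i j : Fin k⦄, i < j → t i < s j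

variable {γ : Curve E} {x x' : E} {r r' R R' : ℝ} {s t : I} {k j : ℕ}

/-- Every curve has `0` traversals of every shell. [cite: AizenmanBurchard1999, §1.b] -/
theorem hasTraversals_zero (γ : Curve E) (x : E) (r R : ℝ) : γ.HasTraversals 0 x r R :=
  ⟨Fin.elim0, Fin.elim0, fun i ↦ i.elim0, fun i ↦ i.elim0⟩

/-- Fewer traversals are easier. [cite: AizenmanBurchard1999, §1.b] -/
theorem HasTraversals.of_le (h : γ.HasTraversals k x r R) (hjk : j ≤ k) :
    γ.HasTraversals j x r R := by
  obtain ⟨s, t, hst, hsep⟩ := h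
  refine ⟨s ∘ Fin.castLE hjk, t ∘ Fin.castLE hjk, fun i ↦ hst _, fun i i' hii' ↦ hsep ?_⟩
  simpa using hii'

/-- A traversal of a shell is a traversal of every shell nested between its two spheres
(larger inner radius, smaller outer radius), also after moving the centre.
[cite: AizenmanBurchard1999, §3.a (proof of Lemma 3.1)] -/
theorem IsTraversal.mono (h : γ.IsTraversal x r R s t) (hr : r + dist x x' ≤ r')
    (hR : R' + dist x x' ≤ R) : γ.IsTraversal x' r' R' s t := by
  refine ⟨h.1, ?_⟩
  have h1 : ∀ p : E, dist p x ≤ r → dist p x' ≤ r' := fun p hp ↦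
    (dist_triangle p x x').trans (by linarith)
  have h2 : ∀ p : E, R ≤ dist p x → R' ≤ dist p x' := fun p hp ↦ by
    linarith [dist_triangle p x' x, dist_comm x x']
  rcases h.2 with ⟨hs, ht⟩ | ⟨hs, ht⟩
  · exact Or.inl ⟨h1 _ hs, h2 _ ht⟩
  · exact Or.inr ⟨h2 _ hs, h1 _ ht⟩

/-- `k` traversals of a shell give `k` traversals of every nested shell, also after moving the
centre (the discretisation step in the proof of AB99 Lemma 3.1).
[cite: AizenmanBurchard1999, §3.a (proof of Lemma 3.1)] -/
theorem HasTraversals.mono (h : γ.HasTraversals k x r R) (hr : r + dist x x' ≤ r')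
    (hR : R' + dist x x' ≤ R) : γ.HasTraversals k x' r' R' := by
  obtain ⟨s, t, hst, hsep⟩ := h
  exact ⟨s, t, fun i ↦ (hst i).mono hr hR, hsep⟩

/-- Same centre: `k` traversals of `D(x; r, R)` give `k` traversals of `D(x; r', R')` whenever
`r ≤ r'` and `R' ≤ R`. [cite: AizenmanBurchard1999, §3.a] -/
theorem HasTraversals.mono' (h : γ.HasTraversals k x r R) (hr : r ≤ r') (hR : R' ≤ R) :
    γ.HasTraversals k x r' R' :=
  h.mono (by simpa using hr) (by simpa using hR)

/-- A traversal of a genuine shell (`r < R`) takes positive time. [cite: AizenmanBurchard1999, §1.b] -/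
theorem IsTraversal.lt (h : γ.IsTraversal x r R s t) (hrR : r < R) : s < t := by
  rcases h.1.lt_or_eq with hlt | rfl
  · exact hlt
  · rcases h.2 with ⟨h1, h2⟩ | ⟨h1, h2⟩ <;> linarith

/-- A constant curve traverses no genuine shell even once. [cite: AizenmanBurchard1999, §1.b] -/
theorem not_hasTraversals_const (p : E) (hk : k ≠ 0) (hrR : r < R) :
    ¬ (const p).HasTraversals k x r R := by
  rintro ⟨s, t, hst, -⟩
  obtain ⟨i⟩ : Nonempty (Fin k) := Fin.pos_iff_nonempty.1 (Nat.pos_of_ne_zero hk)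
  rcases (hst i).2 with ⟨h1, h2⟩ | ⟨h1, h2⟩ <;> simp only [const_apply] at h1 h2 <;> linarith

/-- Traversals of the time-reversed curve are reversed traversals. [cite: AizenmanBurchard1999, §2.a] -/
theorem IsTraversal.reverse (h : γ.IsTraversal x r R s t) :
    γ.reverse.IsTraversal x r R (σ t) (σ s) := by
  refine ⟨unitInterval.symm_le_symm.2 h.1, ?_⟩
  simp only [reverse_apply, unitInterval.symm_symm]
  rcases h.2 with ⟨h1, h2⟩ | ⟨h1, h2⟩
  · exact Or.inr ⟨h2, h1⟩
  · exact Or.inl ⟨h2, h1⟩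

/-- The time-reversed curve has as many separate traversals of a shell as the curve.
[cite: AizenmanBurchard1999, §2.a] -/
theorem HasTraversals.reverse (h : γ.HasTraversals k x r R) : γ.reverse.HasTraversals k x r R := by
  obtain ⟨s, t, hst, hsep⟩ := h
  refine ⟨fun i ↦ σ (t (Fin.rev i)), fun i ↦ σ (s (Fin.rev i)), fun i ↦ (hst _).reverse,
    fun i j hij ↦ unitInterval.symm_lt_symm.2 (hsep ?_)⟩
  exact Fin.rev_lt_rev.2 hij

/-- Reversal invariance of the number of separate traversals. [cite: AizenmanBurchard1999, §2.a] -/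
@[simp] theorem hasTraversals_reverse_iff :
    γ.reverse.HasTraversals k x r R ↔ γ.HasTraversals k x r R :=
  ⟨fun h ↦ by simpa using h.reverse, HasTraversals.reverse⟩

/-- **Every curve traverses a genuine shell only finitely often**: for `r < R` there is `k`
such that `D(x; r, R)` is not traversed by `k` separate segments of `γ`. Each traversal joins
a point within `r` of `x` to a point at distance `≥ R`, so by uniform continuity it occupies a
parameter interval of length `≥ η > 0`, and the intervals are disjoint. (Aizenman–Burchard
1999, §1.a: curves with a short-distance cutoff; for the boundary curve of a domain this is
the finiteness of its excursions across a shell.) [cite: AizenmanBurchard1999, §1.a] -/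
theorem exists_not_hasTraversals (γ : Curve E) (x : E) (hrR : r < R) :
    ∃ k, ¬ γ.HasTraversals k x r R := by
  obtain ⟨η, hη, hcont⟩ := Metric.uniformContinuous_iff.1
    (CompactSpace.uniformContinuous_of_continuous γ.continuous) (R - r) (by linarith)
  obtain ⟨k, hk⟩ := exists_nat_gt (1 / η)
  refine ⟨k, ?_⟩
  rintro ⟨s, t, hst, hsep⟩
  -- each traversal takes time `≥ η`
  have hlen : ∀ i, (s i : ℝ) + η ≤ t i := by
    intro i
    by_contra hlt
    rw [not_le] at hlt
    have hdist : dist (s i) (t i) < η := by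
      rw [Subtype.dist_eq, Real.dist_eq, abs_sub_comm, abs_of_nonneg (by
        have := (hst i).1; exact sub_nonneg.2 (Subtype.coe_le_coe.2 this))]
      linarith
    have hγ := hcont hdist
    rcases (hst i).2 with ⟨h1, h2⟩ | ⟨h1, h2⟩
    · linarith [dist_triangle (γ (t i)) (γ (s i)) x, dist_comm (γ (s i)) (γ (t i))]
    · linarith [dist_triangle (γ (s i)) (γ (t i)) x]
  -- hence `t n ≥ (n + 1) η`
  have hgrow : ∀ (n : ℕ) (hn : n < k), ((n : ℝ) + 1) * η ≤ t ⟨n, hn⟩ := by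
    intro n
    induction n with
    | zero =>
      intro hn
      have := hlen ⟨0, hn⟩
      have h0 : (0 : ℝ) ≤ s ⟨0, hn⟩ := (s _).2.1
      push_cast
      linarith
    | succ n ih =>
      intro hn
      have hprev := ih (by omega)
      have hsep' : (t ⟨n, by omega⟩ : ℝ) < s ⟨n + 1, hn⟩ := by
        have : (⟨n, by omega⟩ : Fin k) < ⟨n + 1, hn⟩ := by
          rw [Fin.lt_def]
          exact Nat.lt_succ_self n
        exact_mod_cast hsep this
      have := hlen ⟨n + 1, hn⟩
      push_cast at hprev ⊢
      linarith
  -- contradiction at the last index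
  rcases Nat.eq_zero_or_pos k with rfl | hkpos
  · have : (0 : ℝ) < 1 / η := by positivity
    simp at hk
    linarith
  · have hlast := hgrow (k - 1) (by omega)
    have ht1 : (t ⟨k - 1, by omega⟩ : ℝ) ≤ 1 := (t _).2.2
    have hk' : ((k - 1 : ℕ) : ℝ) + 1 = k := by
      rw [Nat.cast_sub (by omega)]
      push_cast
      ring
    rw [hk'] at hlast
    have : 1 < (k : ℝ) * η := by rwa [← div_lt_iff₀ hη]
    linarith

end Traversal

/-! ### Divisions and tortuosity -/

section Division

variable [PseudoMetricSpace E]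

/-- `P` is a **division of `γ` of size `ℓ`**: a finite set of times containing `0` and `1` such
that any two times not separated by a point of `P` lying strictly between them — i.e. any two
times in a common segment `[p_i, p_{i+1}]` of consecutive points of `P` — have images at
distance `≤ ℓ`; equivalently, `P` partitions the curve into segments of diameter `≤ ℓ`.
(Aizenman–Burchard, Duke Math. J. 99 (1999), §2.b.) [cite: AizenmanBurchard1999, §2.b] -/
structure IsDivision (γ : Curve E) (ℓ : ℝ) (P : Finset I) : Prop where
  /-- The division starts at time `0`. -/
  zero_mem : (0 : I) ∈ P
  /-- The division ends at time `1`. -/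
  one_mem : (1 : I) ∈ P
  /-- Two times in a common segment of the division have images at distance `≤ ℓ`. -/
  dist_le : ∀ ⦃s u : I⦄, s ≤ u → (∀ p ∈ P, p ≤ s ∨ u ≤ p) → dist (γ s) (γ u) ≤ ℓ

/-- The **tortuosity** `M(γ, ℓ)`: the minimal number of segments of a division of `γ` into
segments of size `≤ ℓ` (`Curve.IsDivision`), i.e. one less than the minimal cardinality of such
a division. Junk value `0` if there is no division (only possible for `ℓ ≤ 0`, by
`Curve.exists_isDivision`). (Aizenman–Burchard, Duke Math. J. 99 (1999), §2.b: "the minimal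
number of segments needed for a partition of the curve into segments of diameter no greater
than `ℓ`".) [cite: AizenmanBurchard1999, §2.b] -/
def tortuosity (γ : Curve E) (ℓ : ℝ) : ℕ :=
  sInf {m | ∃ P : Finset I, γ.IsDivision ℓ P ∧ P.card ≤ m + 1}

variable {γ : Curve E} {ℓ ℓ' : ℝ} {P : Finset I}

/-- A division of size `ℓ` is a division of every larger size. [cite: AizenmanBurchard1999, §2.b] -/
theorem IsDivision.mono (h : γ.IsDivision ℓ P) (hℓ : ℓ ≤ ℓ') : γ.IsDivision ℓ' P :=
  ⟨h.zero_mem, h.one_mem, fun _ _ hsu hP ↦ (h.dist_le hsu hP).trans hℓ⟩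

/-- A division is nonempty (it contains `0`). [cite: AizenmanBurchard1999, §2.b] -/
theorem IsDivision.nonempty (h : γ.IsDivision ℓ P) : P.Nonempty := ⟨0, h.zero_mem⟩

/-- A division has at least two points, `0` and `1`. [cite: AizenmanBurchard1999, §2.b] -/
theorem IsDivision.two_le_card (h : γ.IsDivision ℓ P) : 2 ≤ P.card := by
  have : ({0, 1} : Finset I) ⊆ P := by
    intro p hp
    simp only [Finset.mem_insert, Finset.mem_singleton] at hp
    rcases hp with rfl | rfl
    exacts [h.zero_mem, h.one_mem]
  simpa using Finset.card_le_card this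

/-- The tortuosity is less than the cardinality of any division: `M(γ, ℓ) ≤ #P - 1`.
[cite: AizenmanBurchard1999, §2.b] -/
theorem IsDivision.tortuosity_lt_card (h : γ.IsDivision ℓ P) : γ.tortuosity ℓ < P.card := by
  have hmem : P.card - 1 ∈ {m | ∃ P : Finset I, γ.IsDivision ℓ P ∧ P.card ≤ m + 1} :=
    ⟨P, h, by have := h.two_le_card; omega⟩
  have := Nat.sInf_le hmem
  have h2 := h.two_le_card
  unfold tortuosity
  omega

/-- If `γ` has some division of size `ℓ`, it has one with `M(γ, ℓ) + 1` points (at most).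
[cite: AizenmanBurchard1999, §2.b] -/
theorem exists_isDivision_card_le (h : ∃ P, γ.IsDivision ℓ P) :
    ∃ P, γ.IsDivision ℓ P ∧ P.card ≤ γ.tortuosity ℓ + 1 := by
  obtain ⟨P, hP⟩ := h
  have hne : {m | ∃ P : Finset I, γ.IsDivision ℓ P ∧ P.card ≤ m + 1}.Nonempty :=
    ⟨P.card, P, hP, by omega⟩
  exact Nat.sInf_mem hne

/-- Tortuosity is antitone in the scale, as long as divisions exist at the smaller scale.
[cite: AizenmanBurchard1999, §2.b] -/
theorem tortuosity_anti (h : ∃ P, γ.IsDivision ℓ P) (hℓ : ℓ ≤ ℓ') :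
    γ.tortuosity ℓ' ≤ γ.tortuosity ℓ := by
  obtain ⟨P, hP, hcard⟩ := exists_isDivision_card_le h
  have := (hP.mono hℓ).tortuosity_lt_card
  omega

/-- In a division, the last division point before a time `u` is within `ℓ` of it (along the
curve): if `s ∈ P`, `s ≤ u` and no point of `P` lies in `(s, u)`, then
`dist (γ s) (γ u) ≤ ℓ`. [cite: AizenmanBurchard1999, §2.b] -/
theorem IsDivision.dist_le_of_forall_lt (h : γ.IsDivision ℓ P) {s u : I} (hsu : s ≤ u)
    (hP : ∀ p ∈ P, p ≤ u → p ≤ s) : dist (γ s) (γ u) ≤ ℓ :=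
  h.dist_le hsu fun p hp ↦ (le_or_gt p u).imp (hP p hp) le_of_lt

/-- **Divisions exist** at every positive scale: a continuous curve on the compact interval is
uniformly continuous, so an equally spaced grid of small enough mesh is a division.
(Aizenman–Burchard 1999, §2.b–c, Lemma 2.4, first half: uniform continuity gives tortuosity
bounds.) [cite: AizenmanBurchard1999, Lemma 2.4] -/
theorem exists_isDivision (γ : Curve E) (hℓ : 0 < ℓ) : ∃ P, γ.IsDivision ℓ P := by
  obtain ⟨δ, hδ, hcont⟩ := Metric.uniformContinuous_iff.1
    (CompactSpace.uniformContinuous_of_continuous γ.continuous) ℓ hℓ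
  -- grid of mesh `δ / 3`
  set g : ℕ → I := Set.Icc.addNSMul zero_le_one (δ / 3) with hg
  have hgmono : Monotone g := Set.Icc.monotone_addNSMul zero_le_one (by positivity)
  obtain ⟨m, hm⟩ := Set.Icc.addNSMul_eq_right zero_le_one (δ := δ / 3) (by positivity)
  have hgm : g m = 1 := Subtype.ext (hm m le_rfl)
  have hg0 : g 0 = 0 := Subtype.ext (Set.Icc.addNSMul_zero zero_le_one)
  refine ⟨(Finset.range (m + 1)).image g, ⟨?_, ?_, ?_⟩⟩
  · exact Finset.mem_image.2 ⟨0, by simp, hg0⟩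
  · exact Finset.mem_image.2 ⟨m, by simp, hgm⟩
  · intro s u hsu hP
    -- the last grid point `g n ≤ s`
    classical
    set n := Nat.findGreatest (fun n ↦ g n ≤ s) m with hn
    have hns : g n ≤ s :=
      Nat.findGreatest_spec (P := fun n ↦ g n ≤ s) (Nat.zero_le m) (by rw [hg0]; exact bot_le)
    have hnm : n ≤ m := Nat.findGreatest_le m
    rcases hnm.lt_or_eq with hlt | heq
    · -- `g (n + 1) > s`, hence (not lying strictly between `s` and `u`) `u ≤ g (n + 1)`
      have hnext : s < g (n + 1) := by
        by_contra hle
        exact Nat.findGreatest_is_greatest (P := fun n ↦ g n ≤ s) (Nat.lt_succ_self n) hlt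
          (not_lt.1 hle)
      have hu : u ≤ g (n + 1) := by
        rcases hP (g (n + 1)) (Finset.mem_image.2 ⟨n + 1, by simp; omega, rfl⟩) with h' | h'
        · exact absurd h' (not_le.2 hnext)
        · exact h'
      have hs' : |(s : ℝ) - g n| ≤ δ / 3 :=
        Set.Icc.abs_sub_addNSMul_le zero_le_one (by positivity) n ⟨hns, hnext.le⟩
      have hu' : |(u : ℝ) - g n| ≤ δ / 3 :=
        Set.Icc.abs_sub_addNSMul_le zero_le_one (by positivity) n ⟨hns.trans hsu, hu⟩
      refine (hcont ?_).le
      rw [Subtype.dist_eq, Real.dist_eq]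
      calc |(s : ℝ) - u| = |((s : ℝ) - g n) - ((u : ℝ) - g n)| := by ring_nf
        _ ≤ |(s : ℝ) - g n| + |(u : ℝ) - g n| := abs_sub _ _
        _ < δ := by linarith
    · -- `n = m`: then `s = u = 1`
      have hs1 : s = 1 := le_antisymm unitInterval.le_one' (by rw [← hgm, ← heq]; exact hns)
      have hu1 : u = 1 := le_antisymm unitInterval.le_one' (hs1 ▸ hsu)
      subst hs1 hu1
      simp [hℓ.le]

/-- At positive scale the tortuosity is attained: there is a division with `M(γ, ℓ) + 1`
points (at most). [cite: AizenmanBurchard1999, §2.b] -/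
theorem exists_isDivision_card_le_tortuosity (γ : Curve E) (hℓ : 0 < ℓ) :
    ∃ P, γ.IsDivision ℓ P ∧ P.card ≤ γ.tortuosity ℓ + 1 :=
  exists_isDivision_card_le (γ.exists_isDivision hℓ)

/-- Reversal maps divisions to divisions. [cite: AizenmanBurchard1999, §2.b] -/
theorem IsDivision.reverse (h : γ.IsDivision ℓ P) : γ.reverse.IsDivision ℓ (P.image σ) := by
  refine ⟨Finset.mem_image.2 ⟨1, h.one_mem, unitInterval.symm_one⟩,
    Finset.mem_image.2 ⟨0, h.zero_mem, unitInterval.symm_zero⟩, fun s u hsu hP ↦ ?_⟩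
  rw [reverse_apply, reverse_apply, dist_comm]
  refine h.dist_le (unitInterval.symm_le_symm.2 hsu) fun p hp ↦ ?_
  rcases hP (σ p) (Finset.mem_image.2 ⟨p, hp, rfl⟩) with h' | h'
  · exact Or.inr (unitInterval.symm_le_comm.1 h')
  · exact Or.inl (unitInterval.le_symm_comm.1 h')

/-- Tortuosity is invariant under time reversal. [cite: AizenmanBurchard1999, §2.b] -/
theorem tortuosity_reverse (γ : Curve E) (ℓ : ℝ) : γ.reverse.tortuosity ℓ = γ.tortuosity ℓ := by
  unfold tortuosity
  congr 1
  ext m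
  constructor
  · rintro ⟨P, hP, hcard⟩
    refine ⟨P.image σ, ?_, Finset.card_image_le.trans hcard⟩
    simpa using hP.reverse
  · rintro ⟨P, hP, hcard⟩
    exact ⟨P.image σ, hP.reverse, Finset.card_image_le.trans hcard⟩

end Division

/-! ### The greedy first-exit division (AB99 eq. (2.22)) -/

section Greedy

variable [PseudoMetricSpace E] (γ : Curve E) (a : ℝ)

/-- The exit set after time `s`: the times `t ≥ s` at which the curve is at distance `≥ a`
from `γ s`. (Aizenman–Burchard 1999, proof of Thm 2.5: "the site of the first exit of `γ` from
the ball of radius `ℓ` about `x_n`".) [cite: AizenmanBurchard1999, §2.d (proof of Thm 2.5)] -/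
def exitSet (s : I) : Set I := {t | s ≤ t ∧ a ≤ dist (γ t) (γ s)}

/-- The exit set is closed. [cite: AizenmanBurchard1999, §2.d] -/
theorem isClosed_exitSet (s : I) : IsClosed (γ.exitSet a s) :=
  (isClosed_le continuous_const continuous_id).inter
    (isClosed_le continuous_const (γ.continuous.dist continuous_const))

/-- The first exit time after `s` from the ball of radius `a` about `γ s`: the least element of
the (closed, hence compact) exit set; junk value `1` if the curve never exits.
[cite: AizenmanBurchard1999, §2.d (proof of Thm 2.5)] -/
def exitTime (s : I) : I :=
  haveI := Classical.dec (γ.exitSet a s).Nonempty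
  if h : (γ.exitSet a s).Nonempty then
    ((γ.isClosed_exitSet a s).isCompact.exists_isLeast h).choose
  else 1

/-- The **stopping times of the greedy algorithm** of Aizenman–Burchard: `t₀ = 0` and `t_{n+1}`
is the first exit time after `t_n` from the ball of radius `a` about `γ t_n` (junk `1` from the
first index on at which no exit exists, see `Curve.IsStop`).
[cite: AizenmanBurchard1999, §2.d (proof of Thm 2.5)] -/
def stopSeq : ℕ → I
  | 0 => 0
  | n + 1 => γ.exitTime a (stopSeq n)

/-- `n` is a genuine stopping index: all the exits defining `t₁, …, t_n` exist.
[cite: AizenmanBurchard1999, §2.d (proof of Thm 2.5)] -/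
def IsStop (n : ℕ) : Prop := ∀ m < n, (γ.exitSet a (γ.stopSeq a m)).Nonempty

variable {γ a} {n m : ℕ} {s t : I}

/-- Unfolding `stopSeq` at `0`. [cite: AizenmanBurchard1999, §2.d] -/
@[simp] theorem stopSeq_zero : γ.stopSeq a 0 = 0 := rfl

/-- Unfolding `stopSeq` at a successor. [cite: AizenmanBurchard1999, §2.d] -/
theorem stopSeq_succ (n : ℕ) : γ.stopSeq a (n + 1) = γ.exitTime a (γ.stopSeq a n) := rfl

/-- The first exit time is the least element of a nonempty exit set. [cite: AizenmanBurchard1999, §2.d] -/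
theorem exitTime_isLeast (h : (γ.exitSet a s).Nonempty) :
    IsLeast (γ.exitSet a s) (γ.exitTime a s) := by
  rw [exitTime]
  simp only [dif_pos h]
  exact ((γ.isClosed_exitSet a s).isCompact.exists_isLeast h).choose_spec

/-- `0` is a stopping index. [cite: AizenmanBurchard1999, §2.d] -/
theorem isStop_zero : γ.IsStop a 0 := fun m hm ↦ (Nat.not_lt_zero m hm).elim

/-- Stopping indices form an initial segment. [cite: AizenmanBurchard1999, §2.d] -/
theorem IsStop.of_le (h : γ.IsStop a n) (hmn : m ≤ n) : γ.IsStop a m :=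
  fun i hi ↦ h i (hi.trans_le hmn)

/-- A successor stopping time lies in the exit set of its predecessor. [cite: AizenmanBurchard1999, §2.d] -/
theorem IsStop.stopSeq_succ_mem (h : γ.IsStop a (n + 1)) :
    γ.stopSeq a (n + 1) ∈ γ.exitSet a (γ.stopSeq a n) :=
  (exitTime_isLeast (h n n.lt_succ_self)).1

/-- Stopping times increase. [cite: AizenmanBurchard1999, §2.d] -/
theorem IsStop.stopSeq_le_succ (h : γ.IsStop a (n + 1)) : γ.stopSeq a n ≤ γ.stopSeq a (n + 1) :=
  h.stopSeq_succ_mem.1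

/-- Consecutive stopping points are at distance `≥ a`. [cite: AizenmanBurchard1999, §2.d] -/
theorem IsStop.le_dist_stopSeq_succ (h : γ.IsStop a (n + 1)) :
    a ≤ dist (γ (γ.stopSeq a (n + 1))) (γ (γ.stopSeq a n)) :=
  h.stopSeq_succ_mem.2

/-- Before the next stopping time the curve stays in the open ball of radius `a` about the
current stopping point. [cite: AizenmanBurchard1999, §2.d] -/
theorem IsStop.dist_lt_of_lt (h : γ.IsStop a (n + 1)) (h1 : γ.stopSeq a n ≤ t)
    (h2 : t < γ.stopSeq a (n + 1)) : dist (γ t) (γ (γ.stopSeq a n)) < a := by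
  by_contra hle
  exact h2.not_ge ((exitTime_isLeast (h n n.lt_succ_self)).2 ⟨h1, not_lt.1 hle⟩)

/-- For `a > 0` stopping times increase strictly. [cite: AizenmanBurchard1999, §2.d] -/
theorem IsStop.stopSeq_lt_succ (ha : 0 < a) (h : γ.IsStop a (n + 1)) :
    γ.stopSeq a n < γ.stopSeq a (n + 1) := by
  refine h.stopSeq_le_succ.lt_of_ne fun heq ↦ ?_
  have := h.le_dist_stopSeq_succ
  rw [← heq, dist_self] at this
  exact this.not_gt ha

/-- Consecutive stopping points are at distance exactly `a` (intermediate value theorem), in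
particular at distance `≤ a`. [cite: AizenmanBurchard1999, §2.d] -/
theorem IsStop.dist_stopSeq_succ_le (ha : 0 < a) (h : γ.IsStop a (n + 1)) :
    dist (γ (γ.stopSeq a (n + 1))) (γ (γ.stopSeq a n)) ≤ a := by
  set g : I → ℝ := fun t ↦ dist (γ t) (γ (γ.stopSeq a n)) with hg
  have hgc : Continuous g := γ.continuous.dist continuous_const
  have h0 : g (γ.stopSeq a n) ≤ a := by simp [hg, ha.le]
  obtain ⟨t, ht, hgt⟩ :=
    intermediate_value_Icc h.stopSeq_le_succ hgc.continuousOn ⟨h0, h.le_dist_stopSeq_succ⟩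
  have htmem : t ∈ γ.exitSet a (γ.stopSeq a n) := ⟨ht.1, hgt.ge⟩
  have hle : γ.stopSeq a (n + 1) ≤ t := (exitTime_isLeast (h n n.lt_succ_self)).2 htmem
  have heq : t = γ.stopSeq a (n + 1) := le_antisymm ht.2 hle
  rw [← heq]
  exact hgt.le

/-- On a whole cell `[t_n, t_{n+1}]` the curve stays in the closed ball of radius `a` about
`γ t_n`. [cite: AizenmanBurchard1999, §2.d] -/
theorem IsStop.dist_le_of_mem_Icc (ha : 0 < a) (h : γ.IsStop a (n + 1)) (h1 : γ.stopSeq a n ≤ t)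
    (h2 : t ≤ γ.stopSeq a (n + 1)) : dist (γ t) (γ (γ.stopSeq a n)) ≤ a := by
  rcases h2.lt_or_eq with hlt | rfl
  · exact (h.dist_lt_of_lt h1 hlt).le
  · exact h.dist_stopSeq_succ_le ha

/-- After a stopping time with no exit the curve stays in the open ball of radius `a` for
ever. [cite: AizenmanBurchard1999, §2.d] -/
theorem dist_lt_of_not_nonempty (h : ¬ (γ.exitSet a s).Nonempty) (h1 : s ≤ t) :
    dist (γ t) (γ s) < a := by
  by_contra hle
  exact h ⟨t, h1, not_lt.1 hle⟩

/-- Stopping times are strictly increasing along stopping indices (`a > 0`).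
[cite: AizenmanBurchard1999, §2.d] -/
theorem IsStop.stopSeq_lt (ha : 0 < a) (h : γ.IsStop a n) (hmn : m < n) :
    γ.stopSeq a m < γ.stopSeq a n := by
  induction n with
  | zero => exact (Nat.not_lt_zero m hmn).elim
  | succ n ih =>
    rcases (Nat.lt_succ_iff.1 hmn).lt_or_eq with hlt | rfl
    · exact (ih (h.of_le n.le_succ) hlt).trans (h.stopSeq_lt_succ ha)
    · exact h.stopSeq_lt_succ ha

/-- Stopping times are monotone along stopping indices (`a > 0`). [cite: AizenmanBurchard1999, §2.d] -/
theorem IsStop.stopSeq_le (ha : 0 < a) (h : γ.IsStop a n) (hmn : m ≤ n) :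
    γ.stopSeq a m ≤ γ.stopSeq a n := by
  rcases hmn.lt_or_eq with hlt | rfl
  · exact (h.stopSeq_lt ha hlt).le
  · exact le_rfl

/-- **Stopping points in a small ball produce separate traversals.** If `k + 1` genuine
stopping points `γ t_{i₀}, …, γ t_{i_k}` (`i₀ < ⋯ < i_k`) lie in the closed ball of radius `ρ`
about `y`, with `2ρ < a`, then the segments `[t_{i_j}, t_{i_j + 1}]`, `j < k`, are `k` separate
outward traversals of the shell `D(y; ρ, a - ρ)`: each starts within `ρ` of `y` and ends at
distance `a` from its starting point, and two of them cannot share an endpoint since a point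
cannot be both within `ρ` and beyond `a - ρ > ρ` from `y`. (Aizenman–Burchard 1999, proof of
Thm 2.5: "no such ball will contain more than `k` of the stopping sites".)
[cite: AizenmanBurchard1999, §2.d (proof of Thm 2.5, eq. (2.22))] -/
theorem hasTraversals_of_stopSeq (ha : 0 < a) {ρ : ℝ} (hρ : 2 * ρ < a) {y : E} {k : ℕ}
    (idx : Fin (k + 1) → ℕ) (hidx : StrictMono idx) (hstop : γ.IsStop a (idx (Fin.last k)))
    (hmem : ∀ i, dist (γ (γ.stopSeq a (idx i))) y ≤ ρ) : γ.HasTraversals k y ρ (a - ρ) := by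
  -- every index below the last one has a genuine successor stopping time
  have hst : ∀ i : Fin k, γ.IsStop a (idx i.castSucc + 1) := fun i ↦
    hstop.of_le (Nat.succ_le_of_lt (hidx (Fin.castSucc_lt_last i)))
  have hst' : ∀ i : Fin (k + 1), γ.IsStop a (idx i) := fun i ↦
    hstop.of_le (hidx.monotone (Fin.le_last i))
  have hfar : ∀ i : Fin k, a - ρ ≤ dist (γ (γ.stopSeq a (idx i.castSucc + 1))) y := fun i ↦ by
    have h1 := (hst i).le_dist_stopSeq_succ
    have h2 := hmem i.castSucc
    linarith [dist_triangle (γ (γ.stopSeq a (idx i.castSucc + 1)))  y (γ (γ.stopSeq a (idx i.castSucc))),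
      dist_comm y (γ (γ.stopSeq a (idx i.castSucc)))]
  refine ⟨fun i ↦ γ.stopSeq a (idx i.castSucc), fun i ↦ γ.stopSeq a (idx i.castSucc + 1),
    fun i ↦ ⟨(hst i).stopSeq_le_succ, Or.inl ⟨hmem _, hfar i⟩⟩, fun i j hij ↦ ?_⟩
  have hle : idx i.castSucc + 1 ≤ idx j.castSucc := Nat.succ_le_of_lt (hidx (by simpa using hij))
  rcases hle.lt_or_eq with hlt | heq
  · exact (hst' j.castSucc).stopSeq_lt ha hlt
  · exfalso
    have h1 := hfar i
    have h2 := hmem j.castSucc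
    rw [← heq] at h2
    linarith

/-- **AB99 eq. (2.22): the greedy division.** Let `a > 2ρ ≥ 0`... more precisely `0 < a` and
`2ρ < a`. If the trace of `γ` is covered by the closed `ρ`-balls about the points of a finite
set `S`, and for no `y ∈ S` the shell `D(y; ρ, a - ρ)` is traversed by `k y` separate
segments of `γ`, then `γ` admits a division into at most `∑_{y ∈ S} k y` segments of size
`≤ 2a`; in particular `M(γ, 2a) ≤ ∑_{y ∈ S} k y`. Proof: run the greedy first-exit algorithm
(`Curve.stopSeq`); each cell lies in a ball of radius `a`; by `hasTraversals_of_stopSeq` each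
ball `B̄(y, ρ)` contains at most `k y` stopping points, so there are at most `∑ k y` of them.
(Aizenman–Burchard, Duke Math. J. 99 (1999), proof of Thm 2.5, eq. (2.22):
`M(C, 2ℓ) ≤ k N(C, ℓ^{1+ε})`, stated there with a constant threshold `k` and a covering by
`N(C, ℓ^{1+ε})` sets of diameter `ℓ^{1+ε}`.) [cite: AizenmanBurchard1999, Thm 2.5 eq. (2.22)] -/
theorem exists_isDivision_of_cover (ha : 0 < a) {ρ : ℝ} (hρ : 2 * ρ < a) (S : Finset E)
    (k : E → ℕ) (hcover : γ.range ⊆ ⋃ y ∈ S, closedBall y ρ)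
    (htrav : ∀ y ∈ S, ¬ γ.HasTraversals (k y) y ρ (a - ρ)) :
    ∃ P, γ.IsDivision (2 * a) P ∧ P.card ≤ ∑ y ∈ S, k y + 1 := by
  classical
  -- Step 1: each ball contains at most `k y` stopping points
  have hball : ∀ y ∈ S, ∀ T : Finset ℕ,
      (∀ n ∈ T, γ.IsStop a n ∧ dist (γ (γ.stopSeq a n)) y ≤ ρ) → T.card ≤ k y := by
    intro y hy T hT
    by_contra hlt
    rw [not_le] at hlt
    obtain ⟨T', hT'T, hcard⟩ := Finset.exists_subset_card_eq (Nat.succ_le_of_lt hlt)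
    set idx : Fin (k y + 1) ↪o ℕ := T'.orderEmbOfFin hcard with hidx
    have hmemT : ∀ i, idx i ∈ T := fun i ↦ hT'T (T'.orderEmbOfFin_mem hcard i)
    exact htrav y hy (hasTraversals_of_stopSeq ha hρ idx idx.strictMono (hT _ (hmemT _)).1
      fun i ↦ (hT _ (hmemT i)).2)
  -- the finite sets of stopping indices in each ball
  have hfin : ∀ y ∈ S, {n | γ.IsStop a n ∧ dist (γ (γ.stopSeq a n)) y ≤ ρ}.Finite := by
    intro y hy
    by_contra hinf
    obtain ⟨T, hT, hcard⟩ := Set.Infinite.exists_subset_card_eq hinf (k y + 1)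
    have := hball y hy T fun n hn ↦ hT hn
    omega
  set J : E → Finset ℕ := fun y ↦ if hy : y ∈ S then (hfin y hy).toFinset else ∅ with hJ
  have hJcard : ∀ y ∈ S, (J y).card ≤ k y := by
    intro y hy
    refine hball y hy _ fun n hn ↦ ?_
    simpa [hJ, hy] using hn
  -- Step 2: every stopping index lies in some `J y`
  set F : Finset ℕ := S.biUnion J with hF
  have hFcard : F.card ≤ ∑ y ∈ S, k y :=
    Finset.card_biUnion_le.trans (Finset.sum_le_sum hJcard)
  have hmemF : ∀ n, γ.IsStop a n → n ∈ F := by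
    intro n hn
    have hx : γ (γ.stopSeq a n) ∈ γ.range := ⟨_, rfl⟩
    obtain ⟨y, hy, hyn⟩ : ∃ y ∈ S, dist (γ (γ.stopSeq a n)) y ≤ ρ := by
      simpa only [mem_iUnion, mem_closedBall, exists_prop] using hcover hx
    refine Finset.mem_biUnion.2 ⟨y, hy, ?_⟩
    simp [hJ, hy, hn, hyn]
  -- Step 3: the stopping indices are `0, …, m - 1` with `1 ≤ m ≤ #F`
  have hbound : ∀ n, γ.IsStop a n → n + 1 ≤ F.card := by
    intro n hn
    have hsub : Finset.range (n + 1) ⊆ F := fun i hi ↦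
      hmemF i (hn.of_le (Nat.lt_succ_iff.1 (Finset.mem_range.1 hi)))
    simpa using Finset.card_le_card hsub
  have hex : ∃ n, ¬ γ.IsStop a n := ⟨F.card, fun h ↦ by have := hbound _ h; omega⟩
  set m := Nat.find hex with hm
  have hm_not : ¬ γ.IsStop a m := Nat.find_spec hex
  have hm_stop : ∀ n, n < m → γ.IsStop a n := fun n hn ↦ by
    have := Nat.find_min hex (m := n) hn
    tauto
  have hm_pos : 0 < m := by
    rw [hm, Nat.find_pos]
    exact fun h ↦ h isStop_zero
  have hm_le : m ≤ F.card := by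
    have := hbound (m - 1) (hm_stop _ (Nat.sub_lt hm_pos Nat.one_pos))
    omega
  -- the last stopping time has no exit
  have hlast : ¬ (γ.exitSet a (γ.stopSeq a (m - 1))).Nonempty := by
    intro hne
    refine hm_not fun i hi ↦ ?_
    rcases (Nat.le_of_lt_succ (by omega : i < m - 1 + 1)).lt_or_eq with hlt | rfl
    · exact hm_stop (m - 1) (Nat.sub_lt hm_pos Nat.one_pos) i hlt
    · exact hne
  -- Step 4: the division
  refine ⟨(Finset.range m).image (γ.stopSeq a) ∪ {1}, ⟨?_, by simp, ?_⟩, ?_⟩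
  · exact Finset.mem_union_left _ (Finset.mem_image.2 ⟨0, by simpa using hm_pos, rfl⟩)
  · intro s u hsu hP
    -- the last stopping index `n < m` with `t_n ≤ s`
    set n := Nat.findGreatest (fun n ↦ γ.stopSeq a n ≤ s) (m - 1) with hn
    have hns : γ.stopSeq a n ≤ s :=
      Nat.findGreatest_spec (P := fun n ↦ γ.stopSeq a n ≤ s) (Nat.zero_le _) (by simp)
    have hnm : n ≤ m - 1 := Nat.findGreatest_le _
    have hsd : ∀ v : I, γ.stopSeq a n ≤ v → (n + 1 ≤ m - 1 → v ≤ γ.stopSeq a (n + 1)) →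
        dist (γ v) (γ (γ.stopSeq a n)) ≤ a := by
      intro v hv1 hv2
      rcases hnm.lt_or_eq with hlt | heq
      · have hst : γ.IsStop a (n + 1) := hm_stop _ (by omega)
        exact hst.dist_le_of_mem_Icc ha hv1 (hv2 (by omega))
      · have : ¬ (γ.exitSet a (γ.stopSeq a n)).Nonempty := heq ▸ hlast
        exact (dist_lt_of_not_nonempty this hv1).le
    have hnext : n + 1 ≤ m - 1 → u ≤ γ.stopSeq a (n + 1) := by
      intro hn1
      have hgt : s < γ.stopSeq a (n + 1) := by
        by_contra hle
        exact Nat.findGreatest_is_greatest (P := fun n ↦ γ.stopSeq a n ≤ s) (Nat.lt_succ_self n)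
          hn1 (not_lt.1 hle)
      rcases hP (γ.stopSeq a (n + 1)) (Finset.mem_union_left _
        (Finset.mem_image.2 ⟨n + 1, by simp; omega, rfl⟩)) with h' | h'
      · exact absurd h' (not_le.2 hgt)
      · exact h'
    calc dist (γ s) (γ u)
        ≤ dist (γ s) (γ (γ.stopSeq a n)) + dist (γ u) (γ (γ.stopSeq a n)) :=
          dist_triangle_right _ _ _
      _ ≤ a + a := add_le_add (hsd s hns fun h ↦ hsu.trans (hnext h))
          (hsd u (hns.trans hsu) hnext)
      _ = 2 * a := by ring
  · calc ((Finset.range m).image (γ.stopSeq a) ∪ {1}).card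
        ≤ ((Finset.range m).image (γ.stopSeq a)).card + ({1} : Finset I).card :=
          Finset.card_union_le _ _
      _ ≤ m + 1 := by
          gcongr
          · exact Finset.card_image_le.trans (by simp)
          · simp
      _ ≤ ∑ y ∈ S, k y + 1 := by omega

/-- **AB99 eq. (2.22)**, tortuosity form: under the hypotheses of `exists_isDivision_of_cover`,
`M(γ, 2a) ≤ ∑_{y ∈ S} k y`. [cite: AizenmanBurchard1999, Thm 2.5 eq. (2.22)] -/
theorem tortuosity_le_of_cover (ha : 0 < a) {ρ : ℝ} (hρ : 2 * ρ < a) (S : Finset E)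
    (k : E → ℕ) (hcover : γ.range ⊆ ⋃ y ∈ S, closedBall y ρ)
    (htrav : ∀ y ∈ S, ¬ γ.HasTraversals (k y) y ρ (a - ρ)) :
    γ.tortuosity (2 * a) ≤ ∑ y ∈ S, k y := by
  obtain ⟨P, hP, hcard⟩ := exists_isDivision_of_cover ha hρ S k hcover htrav
  have := hP.tortuosity_lt_card
  omega

end Greedy

end Curve

/-! ### Increasing homeomorphisms of `[0, 1]` through prescribed points -/

section OrderIso

/-- **Matching two finite sets of times.** Two strictly increasing finite sequences of times
in `[0, 1]` of the same length, both containing `0` and `1`, are mapped onto each other by an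
increasing self-homeomorphism (order automorphism) of `[0, 1]` — the piecewise linear
interpolation, written as a positive combination of the ramps
`t ↦ max uⱼ (min t uⱼ₊₁) - uⱼ`. This is the reparametrisation matching two divisions used in
the compactness criterion below (Aizenman–Burchard 1999, §2.a: reparametrisations are the
strictly monotone continuous functions of `[0, 1]` onto itself). [cite: AizenmanBurchard1999, §2.a] -/
theorem exists_orderIso_unitInterval_apply_eq {k : ℕ} (u v : Fin k → I) (hu : StrictMono u)
    (hv : StrictMono v) (hu0 : (0 : I) ∈ Set.range u) (hu1 : (1 : I) ∈ Set.range u)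
    (hv0 : (0 : I) ∈ Set.range v) (hv1 : (1 : I) ∈ Set.range v) :
    ∃ φ : I ≃o I, ∀ i, φ (u i) = v i := by
  -- `k ≥ 1`; the first terms are `0`, the last ones are `1`
  obtain ⟨i₀, hi₀⟩ := hu0
  have hk : 0 < k := Fin.pos i₀
  obtain ⟨n, rfl⟩ : ∃ n, k = n + 1 := ⟨k - 1, by omega⟩
  have first_eq : ∀ (w : Fin (n + 1) → I), StrictMono w → (0 : I) ∈ Set.range w → w 0 = 0 := by
    rintro w hw ⟨i, hi⟩
    exact le_antisymm (hi ▸ hw.monotone (Fin.zero_le i)) bot_le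
  have last_eq : ∀ (w : Fin (n + 1) → I), StrictMono w → (1 : I) ∈ Set.range w →
      w (Fin.last n) = 1 := by
    rintro w hw ⟨i, hi⟩
    exact le_antisymm le_top (hi ▸ hw.monotone (Fin.le_last i))
  have hu0' := first_eq u hu ⟨i₀, hi₀⟩
  have hv0' := first_eq v hv hv0
  have hu1' := last_eq u hu hu1
  have hv1' := last_eq v hv hv1
  -- real sequences extended by `1`
  set U : ℕ → ℝ := fun j ↦ if h : j < n + 1 then (u ⟨j, h⟩ : ℝ) else 1 with hU
  set V : ℕ → ℝ := fun j ↦ if h : j < n + 1 then (v ⟨j, h⟩ : ℝ) else 1 with hV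
  have hUu : ∀ i : Fin (n + 1), U i = u i := fun i ↦ by simp only [hU]; rw [dif_pos i.is_lt]
  have hVv : ∀ i : Fin (n + 1), V i = v i := fun i ↦ by simp only [hV]; rw [dif_pos i.is_lt]
  have hUmono : StrictMonoOn U (Set.Iio (n + 1)) := by
    intro i hi j hj hij
    simp only [Set.mem_Iio] at hi hj
    simp only [hU, hi, hj, dite_true]
    exact_mod_cast hu (show (⟨i, hi⟩ : Fin (n + 1)) < ⟨j, hj⟩ from hij)
  have hVmono : StrictMonoOn V (Set.Iio (n + 1)) := by
    intro i hi j hj hij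
    simp only [Set.mem_Iio] at hi hj
    simp only [hV, hi, hj, dite_true]
    exact_mod_cast hv (show (⟨i, hi⟩ : Fin (n + 1)) < ⟨j, hj⟩ from hij)
  have hUlt : ∀ j, j < n → U j < U (j + 1) := fun j hj ↦
    hUmono (by simp; omega) (by simp; omega) j.lt_succ_self
  have hVlt : ∀ j, j < n → V j < V (j + 1) := fun j hj ↦
    hVmono (by simp; omega) (by simp; omega) j.lt_succ_self
  have hUle : ∀ i j, i ≤ j → j < n + 1 → U i ≤ U j := fun i j hij hj ↦
    hUmono.monotoneOn (by simp; omega) (by simp; omega) hij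
  have hU0 : U 0 = 0 := by rw [show ((0 : ℕ) : ℕ) = ((0 : Fin (n + 1)) : ℕ) from rfl, hUu, hu0']; rfl
  have hV0 : V 0 = 0 := by rw [show ((0 : ℕ) : ℕ) = ((0 : Fin (n + 1)) : ℕ) from rfl, hVv, hv0']; rfl
  have hUn : U n = 1 := by rw [show (n : ℕ) = ((Fin.last n : Fin (n + 1)) : ℕ) from rfl, hUu, hu1']; rfl
  have hVn : V n = 1 := by rw [show (n : ℕ) = ((Fin.last n : Fin (n + 1)) : ℕ) from rfl, hVv, hv1']; rfl
  -- slopes and the interpolating function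
  set c : ℕ → ℝ := fun j ↦ (V (j + 1) - V j) / (U (j + 1) - U j) with hc
  have hcpos : ∀ j, j < n → 0 < c j := fun j hj ↦
    div_pos (sub_pos.2 (hVlt j hj)) (sub_pos.2 (hUlt j hj))
  set ramp : ℕ → ℝ → ℝ := fun j t ↦ max (U j) (min t (U (j + 1))) - U j with hramp
  have ramp_mono : ∀ j, Monotone (ramp j) := fun j s t hst ↦ by
    simp only [hramp]
    gcongr
  set f : ℝ → ℝ := fun t ↦ ∑ j ∈ Finset.range n, c j * ramp j t with hf
  have hfc : Continuous f := by
    refine continuous_finsetSum _ fun j _ ↦ continuous_const.mul ?_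
    exact (continuous_const.max (continuous_id.min continuous_const)).sub continuous_const
  have hfmono : Monotone f := fun s t hst ↦
    Finset.sum_le_sum fun j hj ↦ mul_le_mul_of_nonneg_left (ramp_mono j hst)
      (hcpos j (Finset.mem_range.1 hj)).le
  -- values at the nodes
  have hfU : ∀ i, i < n + 1 → f (U i) = V i := by
    intro i hi
    have hin : i ≤ n := Nat.lt_succ_iff.1 hi
    have h1 : ∀ j ∈ Finset.range i, c j * ramp j (U i) = V (j + 1) - V j := by
      intro j hj
      have hj' := Finset.mem_range.1 hj
      have hmin : min (U i) (U (j + 1)) = U (j + 1) := min_eq_right (hUle _ _ hj' hi)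
      have hmax : max (U j) (U (j + 1)) = U (j + 1) := max_eq_right (hUlt j (by omega)).le
      simp only [hramp, hmin, hmax, hc]
      rw [div_mul_cancel₀ _ (sub_pos.2 (hUlt j (by omega))).ne']
    have h2 : ∀ j ∈ Finset.Ico i n, c j * ramp j (U i) = 0 := by
      intro j hj
      obtain ⟨hij, hjn⟩ := Finset.mem_Ico.1 hj
      have hmin : min (U i) (U (j + 1)) = U i := min_eq_left (hUle _ _ (by omega) (by omega))
      have hmax : max (U j) (U i) = U j := max_eq_left (hUle _ _ hij (by omega))
      simp [hramp, hmin, hmax]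
    calc f (U i) = ∑ j ∈ Finset.range i, c j * ramp j (U i)
          + ∑ j ∈ Finset.Ico i n, c j * ramp j (U i) := (Finset.sum_range_add_sum_Ico _ hin).symm
      _ = ∑ j ∈ Finset.range i, (V (j + 1) - V j) + 0 := by
          rw [Finset.sum_congr rfl h1, Finset.sum_eq_zero h2]
      _ = V i := by rw [Finset.sum_range_sub, hV0]; ring
  have hf0 : f 0 = 0 := by simpa [hU0, hV0] using hfU 0 (by omega)
  have hf1 : f 1 = 1 := by simpa [hUn, hVn] using hfU n (by omega)
  -- strict monotonicity on `[0, 1]`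
  have hfstrict : StrictMonoOn f (Set.Icc 0 1) := by
    intro s hs t ht hst
    classical
    -- the last node `U j₀ ≤ s`, with `j₀ < n`
    set j₀ := Nat.findGreatest (fun j ↦ U j ≤ s) n with hj₀
    have hj₀s : U j₀ ≤ s := Nat.findGreatest_spec (P := fun j ↦ U j ≤ s) (Nat.zero_le n)
      (by simpa [hU0] using hs.1)
    have hj₀n : j₀ ≤ n := Nat.findGreatest_le n
    have hj₀lt : j₀ < n := by
      refine hj₀n.lt_of_ne fun heq ↦ ?_
      have : (1 : ℝ) ≤ s := by rw [← hUn, ← heq]; exact hj₀s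
      linarith [ht.2]
    have hnext : s < U (j₀ + 1) := by
      by_contra hle
      exact Nat.findGreatest_is_greatest (P := fun j ↦ U j ≤ s) (Nat.lt_succ_self _)
        (Nat.succ_le_of_lt hj₀lt) (not_lt.1 hle)
    refine Finset.sum_lt_sum (fun j hj ↦ mul_le_mul_of_nonneg_left (ramp_mono j hst.le)
      (hcpos j (Finset.mem_range.1 hj)).le) ⟨j₀, Finset.mem_range.2 hj₀lt, ?_⟩
    refine mul_lt_mul_of_pos_left ?_ (hcpos j₀ hj₀lt)
    simp only [hramp]
    have h1 : max (U j₀) (min s (U (j₀ + 1))) = s := by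
      rw [min_eq_left hnext.le, max_eq_right hj₀s]
    have h2 : s < max (U j₀) (min t (U (j₀ + 1))) := lt_max_of_lt_right (lt_min hst hnext)
    linarith
  -- `f` maps `[0, 1]` onto `[0, 1]`
  have hfmem : ∀ t : I, f t ∈ I := fun t ↦
    ⟨hf0 ▸ hfmono t.2.1, hf1 ▸ hfmono t.2.2⟩
  set φ : I → I := fun t ↦ ⟨f t, hfmem t⟩ with hφ
  have hφmono : StrictMono φ := fun s t hst ↦ hfstrict s.2 t.2 hst
  have hφsurj : Function.Surjective φ := by
    intro y
    have hy : (y : ℝ) ∈ Set.Icc (f 0) (f 1) := by rw [hf0, hf1]; exact y.2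
    obtain ⟨x, hx, hfx⟩ := intermediate_value_Icc zero_le_one hfc.continuousOn hy
    exact ⟨⟨x, hx⟩, Subtype.ext hfx⟩
  refine ⟨hφmono.orderIsoOfSurjective φ hφsurj, fun i ↦ Subtype.ext ?_⟩
  rw [StrictMono.coe_orderIsoOfSurjective]
  change f (u i) = v i
  rw [← hUu, ← hVv]
  exact hfU i i.2

end OrderIso

/-! ### Compactness in curve space from uniform tortuosity bounds (AB99 Lemma 4.1) -/

namespace CurveClass

variable [PseudoMetricSpace E]

/-- **Two curves with matching divisions and nearby division points are close.** If `P₁`, `P₂`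
are divisions of size `ℓ` of `γ₁`, `γ₂` with the same number of points, and the `j`-th points
of `γ₁` on `P₁` and of `γ₂` on `P₂` are within `2ℓ` of each other for every `j`, then
`dist (mk γ₁) (mk γ₂) ≤ 4ℓ`: reparametrise `γ₂` by the order automorphism of `[0, 1]` matching
`P₁` with `P₂` (`exists_orderIso_unitInterval_apply_eq`) and compare each time with the last
division point before it. (Aizenman–Burchard 1999, proof of Lemma 4.1.)
[cite: AizenmanBurchard1999, Lemma 4.1] -/
theorem dist_mk_mk_le_of_isDivision {γ₁ γ₂ : Curve E} {ℓ : ℝ} {P₁ P₂ : Finset I}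
    (h₁ : γ₁.IsDivision ℓ P₁) (h₂ : γ₂.IsDivision ℓ P₂) (hcard : P₂.card = P₁.card)
    (hnear : ∀ j : Fin P₁.card,
      dist (γ₁ (P₁.orderEmbOfFin rfl j)) (γ₂ (P₂.orderEmbOfFin hcard j)) ≤ 2 * ℓ) :
    dist (mk γ₁) (mk γ₂) ≤ 4 * ℓ := by
  classical
  set e₁ : Fin P₁.card ↪o I := P₁.orderEmbOfFin rfl with he₁
  set e₂ : Fin P₁.card ↪o I := P₂.orderEmbOfFin hcard with he₂
  have hr₁ : Set.range e₁ = P₁ := P₁.range_orderEmbOfFin rfl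
  have hr₂ : Set.range e₂ = P₂ := P₂.range_orderEmbOfFin hcard
  obtain ⟨φ, hφ⟩ := exists_orderIso_unitInterval_apply_eq e₁ e₂ e₁.strictMono e₂.strictMono
    (by rw [hr₁]; exact h₁.zero_mem) (by rw [hr₁]; exact h₁.one_mem)
    (by rw [hr₂]; exact h₂.zero_mem) (by rw [hr₂]; exact h₂.one_mem)
  have hℓ : 0 ≤ ℓ := by
    have := h₁.dist_le (le_refl (0 : I)) fun p _ ↦ (le_or_gt p 0).imp id le_of_lt
    simpa using this
  rw [dist_mk_mk]
  refine (Curve.reparamDist_le γ₁ γ₂ φ).trans ((ContinuousMap.dist_le (by positivity)).2 fun t ↦ ?_)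
  change dist (γ₁ t) (γ₂ (φ t)) ≤ 4 * ℓ
  -- the last division point `p ≤ t` of `P₁`
  set A : Finset I := P₁.filter (· ≤ t) with hA
  have hAne : A.Nonempty := ⟨0, Finset.mem_filter.2 ⟨h₁.zero_mem, bot_le⟩⟩
  set p : I := A.max' hAne with hp
  have hpA : p ∈ A := A.max'_mem hAne
  have hpP : p ∈ P₁ := (Finset.mem_filter.1 hpA).1
  have hpt : p ≤ t := (Finset.mem_filter.1 hpA).2
  have hpmax : ∀ p' ∈ P₁, p' ≤ t → p' ≤ p := fun p' hp' hp't ↦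
    A.le_max' p' (Finset.mem_filter.2 ⟨hp', hp't⟩)
  obtain ⟨j, hj⟩ : p ∈ Set.range e₁ := by rw [hr₁]; exact hpP
  -- (i) `γ₁ t` is within `ℓ` of `γ₁ p`
  have d1 : dist (γ₁ p) (γ₁ t) ≤ ℓ := h₁.dist_le_of_forall_lt hpt hpmax
  -- (ii) `γ₁ p = γ₁ (e₁ j)` is within `2ℓ` of `γ₂ (e₂ j)`
  have d2 : dist (γ₁ p) (γ₂ (e₂ j)) ≤ 2 * ℓ := hj ▸ hnear j
  -- (iii) `γ₂ (φ t)` is within `ℓ` of `γ₂ (e₂ j) = γ₂ (φ p)`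
  have d3 : dist (γ₂ (e₂ j)) (γ₂ (φ t)) ≤ ℓ := by
    refine h₂.dist_le_of_forall_lt ?_ fun p' hp' hp't ↦ ?_
    · rw [← hφ j, hj]
      exact φ.monotone hpt
    · obtain ⟨i, rfl⟩ : p' ∈ Set.range e₂ := by rw [hr₂]; exact hp'
      rw [← hφ i] at hp't ⊢
      rw [← hφ j]
      refine φ.monotone (hj ▸ hpmax _ ?_ (φ.le_iff_le.1 hp't))
      rw [← Finset.mem_coe, ← hr₁]
      exact ⟨i, rfl⟩
  calc dist (γ₁ t) (γ₂ (φ t))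
      ≤ dist (γ₁ t) (γ₁ p) + dist (γ₁ p) (γ₂ (e₂ j)) + dist (γ₂ (e₂ j)) (γ₂ (φ t)) :=
        dist_triangle4 _ _ _ _
    _ ≤ ℓ + 2 * ℓ + ℓ := by rw [dist_comm] at d1; gcongr
    _ = 4 * ℓ := by ring

/-- **AB99 Lemma 4.1 (⇐): compactness from uniform tortuosity bounds.** Let `Λ` be a compact
subset of a complete (pseudo-)metric space `E`, `L : ι → ℝ` a family of scales containing
arbitrarily small positive ones, and `Φ : ι → ℕ` any bounds. Then the classes of the curves
lying in `Λ` whose tortuosity satisfies `M(γ, L i) ≤ Φ i` for all `i` form a relatively compact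
subset of the space `CurveClass E` of curves modulo reparametrisation. Proof: `CurveClass E` is
complete, so it suffices to prove total boundedness
(`Metric.totallyBounded_of_finite_discretization`): at a scale `ℓ = L i ≤ η / 8`, encode a class
by the number of points of a minimal division of a representative and the points of a finite
`ℓ`-net of `Λ` near its division points; two classes with the same code are at distance
`≤ 4ℓ < η` by `dist_mk_mk_le_of_isDivision`.
(Aizenman–Burchard, Duke Math. J. 99 (1999), Lemma 4.1, "if" direction, proved there via
Lemma 2.4 and the Arzelà–Ascoli theorem.) [cite: AizenmanBurchard1999, Lemma 4.1] -/
theorem isCompact_closure_image_mk_of_tortuosity_le [CompleteSpace E] {Λ : Set E}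
    (hΛ : IsCompact Λ) {ι : Type*} (L : ι → ℝ) (Φ : ι → ℕ)
    (hL : ∀ η > 0, ∃ i, 0 < L i ∧ L i ≤ η) :
    IsCompact (closure (mk '' {γ : Curve E | γ.range ⊆ Λ ∧ ∀ i, γ.tortuosity (L i) ≤ Φ i})) := by
  classical
  set 𝒦 : Set (Curve E) := {γ | γ.range ⊆ Λ ∧ ∀ i, γ.tortuosity (L i) ≤ Φ i} with h𝒦
  refine (TotallyBounded.closure ?_).isCompact_of_isClosed isClosed_closure
  refine Metric.totallyBounded_of_finite_discretization fun η hη ↦ ?_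
  obtain ⟨i₀, hℓ, hℓη⟩ := hL (η / 8) (by positivity)
  set ℓ := L i₀ with hℓdef
  obtain ⟨T, -, hTfin, hTcov⟩ := finite_cover_balls_of_compact hΛ hℓ
  haveI : Fintype T := hTfin.fintype
  set N := Φ i₀ with hN
  -- data attached to each class: a representative, a small division, net points
  have key : ∀ c : ↥(mk '' 𝒦), ∃ (γ : Curve E) (P : Finset I) (q : I → E),
      mk γ = c ∧ γ.IsDivision ℓ P ∧ P.card ≤ N + 1 ∧ ∀ t, q t ∈ T ∧ dist (γ t) (q t) < ℓ := by
    rintro ⟨c, γ, ⟨hγΛ, hγM⟩, rfl⟩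
    obtain ⟨P, hP, hPcard⟩ := γ.exists_isDivision_card_le_tortuosity hℓ
    have hq : ∀ t : I, ∃ q ∈ T, dist (γ t) q < ℓ := fun t ↦ by
      have := hTcov (hγΛ ⟨t, rfl⟩)
      simpa only [mem_iUnion, mem_ball, exists_prop] using this
    choose q hqT hqd using hq
    refine ⟨γ, P, q, rfl, hP, hPcard.trans ?_, fun t ↦ ⟨hqT t, hqd t⟩⟩
    have := hγM i₀
    simp only [hℓdef, hN]
    omega
  choose γ P q hmk hP hcard hq using key
  -- the code
  let code : ↥(mk '' 𝒦) → Fin (N + 2) × (Fin (N + 1) → T) := fun c ↦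
    (⟨(P c).card, by have := hcard c; omega⟩,
      fun j ↦ if h : (j : ℕ) < (P c).card then ⟨q c ((P c).orderEmbOfFin rfl ⟨j, h⟩), (hq c _).1⟩
        else ⟨q c 0, (hq c _).1⟩)
  refine ⟨_, inferInstance, code, fun c₁ c₂ hcode ↦ ?_⟩
  simp only [code, Prod.mk.injEq, Fin.mk.injEq] at hcode
  obtain ⟨hcardeq, hfun⟩ := hcode
  have hdist : dist (mk (γ c₁)) (mk (γ c₂)) ≤ 4 * ℓ := by
    refine dist_mk_mk_le_of_isDivision (hP c₁) (hP c₂) hcardeq.symm fun j ↦ ?_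
    have hj₁ : (j : ℕ) < (P c₁).card := j.2
    have hj₂ : (j : ℕ) < (P c₂).card := hcardeq ▸ j.2
    have hjN : (j : ℕ) < N + 1 := lt_of_lt_of_le j.2 (hcard c₁)
    have := congr_fun hfun ⟨j, hjN⟩
    simp only [dif_pos hj₁, dif_pos hj₂, Subtype.mk.injEq] at this
    -- the two embeddings of `P c₂` agree
    have he : (P c₂).orderEmbOfFin rfl ⟨j, hj₂⟩ = (P c₂).orderEmbOfFin hcardeq.symm j := by
      rw [Finset.orderEmbOfFin_eq_orderEmbOfFin_iff]
    calc dist (γ c₁ ((P c₁).orderEmbOfFin rfl j)) (γ c₂ ((P c₂).orderEmbOfFin hcardeq.symm j))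
        ≤ dist (γ c₁ ((P c₁).orderEmbOfFin rfl j)) (q c₁ ((P c₁).orderEmbOfFin rfl ⟨j, hj₁⟩))
          + dist (q c₁ ((P c₁).orderEmbOfFin rfl ⟨j, hj₁⟩))
            (γ c₂ ((P c₂).orderEmbOfFin hcardeq.symm j)) := dist_triangle _ _ _
      _ ≤ ℓ + ℓ := by
          gcongr
          · exact (hq c₁ _).2.le
          · rw [this, dist_comm, ← he]
            exact (hq c₂ _).2.le
      _ = 2 * ℓ := by ring
  calc dist (c₁ : CurveClass E) c₂ = dist (mk (γ c₁)) (mk (γ c₂)) := by rw [hmk, hmk]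
    _ ≤ 4 * ℓ := hdist
    _ < η := by linarith

end CurveClass

end Literature.Probability.RandomPlanarGeometry
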